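import Mathlib
import Literature.NumberTheory.LFunctions.WeilExplicit
import Literature.NumberTheory.LFunctions.WeilExplicitProofs
import Literature.NumberTheory.LFunctions.WeilGroundEnergyProofs
import Literature.NumberTheory.LFunctions.WeilGroundState
import Literature.NumberTheory.LFunctions.WeilMellinBounds
import Literature.NumberTheory.LFunctions.WeilExplicitFormulaProofs
import Literature.NumberTheory.LFunctions.WeilCriterionConverse
import Literature.NumberTheory.LFunctions.WeilGroundStateRealZerosProofs
import HarnessLib

/-!
# RiemannHypothesis / WeilGroundState — ground energy bounded below implies RH (sub-goal (E))

Route `RiemannHypothesis/WeilGroundState`, crux item stmt-RiemannHypothesis-1527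
(`GroundStatesConvergeToXi`), line `Sketch`, registered sub-goal (E)
`riemannHypothesis_of_weilGroundEnergy_bddBelow` of the lead's hardness programme "RH from
non-degenerate tight ground states" (helper file, `--supports`).

**Statement.** If the ground energies `ε(a) = weilGroundEnergy a` of Weil's truncated quadratic
form `Q(g) = W(g ⋆ g̃)` (infimum of `Re Q` over the `L²`-unit sphere of test functions supported
in `[-a, a]`) are bounded below uniformly in the window `a > 0`, then Mathlib's
`RiemannHypothesis` holds. This strengthens the converse ("if") half of Weil's criterion
(`RH ⟸ ε ≥ 0`, Bombieri 2000 Thm. 1; tree file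
`Literature/NumberTheory/LFunctions/WeilCriterionConverse.lean`).

**Proof.** A small modification of the tree's proof of the converse half
(`WeilConverse.riemannHypothesis_of_zeroSide_nonneg`), in which positivity `Re Q ≥ 0` enters only
through the bound `|B_g(x)| ≤ Re Q(g)` for the exponential series
`B_g(x) = Σ_ρ m(ρ) P_g(ρ) e^{(ρ - 1/2)x}` (`WeilConverse.norm_expSum_le`). Replace `L` by
`min L 0 ≤ 0`. For a test function `f` (supported in some `[-a, a]`, `a > 0`) the definition of
`ε` and the explicit formula (`explicit_formula_holds`, identifying `WeilConverse.zeroForm f` with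
`Q(f)`) give `L ∫|f|² ≤ ε(a) ∫|f|² ≤ Re Q(f)` (`ConnesVanSuijlekom.weilGroundEnergy_mul_le_re`).
Applied to `f = g + c g_x` (`WeilConverse.translateMix`, `|c| = 1`, `∫|f|² ≤ 4 ∫|g|²`) with
`c = -conj B_g(x)/|B_g(x)|` and the polarisation/translation expansion
`WeilConverse.zeroForm_translateMix`, this yields the uniform bound
`|B_g(x)| ≤ Re Q(g) - 2 L ∫|g|²`. A bounded absolutely convergent exponential sum with locally
finite exponents has no terms off the imaginary axis
(`Literature.Analysis.Complex.BoundedPowerSum.sum_fiber_eq_zero_of_exp_real`), so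
`m(ρ) P_g(ρ) = 0` whenever `Re ρ ≠ 1/2`; a narrow bump with `Re ĝ > 0` on the horizontal line
through `ρ` (`exists_isWeilTest_re_weilMellin_pos`) then forces `Re ρ = 1/2` for every
non-trivial zero, and `riemannHypothesis_iff_strip_holds` converts the strip form into Mathlib's
`RiemannHypothesis` — verbatim as in `WeilConverse.re_eq_one_half`.

Mathlib + proved tree material only (`WeilCriterionConverse.lean`, `explicit_formula_holds`,
`ConnesVanSuijlekom.weilGroundEnergy_mul_le_re`, `BoundedPowerSums.lean`); no named fact is used;
no definitions.
-/

set_option linter.dupNamespace false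

noncomputable section

open MeasureTheory Complex Filter Set
open scoped Real Topology ComplexConjugate

namespace Summit.RiemannHypothesis.RiemannHypothesis.Theorems.GroundStatesConvergeToXi

open Literature.NumberTheory.LFunctions

/-- A test function is supported in a symmetric window `[-r, r]` with `r ≥ 1`. [folklore] -/
theorem energyBddBelow_exists_tsupport_subset {g : ℝ → ℂ} (hg : IsWeilTest g) :
    ∃ r : ℝ, 1 ≤ r ∧ tsupport g ⊆ Icc (-r) r := by
  obtain ⟨R, hR⟩ := hg.2.isCompact.isBounded.subset_closedBall 0
  refine ⟨max R 1, le_max_right _ _, fun t ht ↦ ?_⟩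
  have h := hR ht
  rw [Metric.mem_closedBall, dist_zero_right, Real.norm_eq_abs] at h
  have h' : |t| ≤ max R 1 := h.trans (le_max_left _ _)
  exact ⟨by linarith [neg_abs_le t], (le_abs_self t).trans h'⟩

/-- **The lower bound transported to the zero side.** If `L ≤ ε(a)` for all `a > 0`, then
`L ∫|f|² ≤ Re Σ_ρ m(ρ) P_f(ρ)` for every test function `f`: choose a window `[-r, r] ⊇ supp f`
with `r ≥ 1` and use `L ∫|f|² ≤ ε(r) ∫|f|² ≤ Re Q(f)` (`ConnesVanSuijlekom.weilGroundEnergy_mul_le_re`)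
together with `zeroForm f = Q(f)`: both `WeilConverse.zeroForm f`
(`WeilConverse.hasWeilZeroSide_zeroForm`) and `Q(f) = W(f ⋆ f̃)` (the proved explicit formula
`explicit_formula_holds` at the test function `f ⋆ f̃`) are the limit of the symmetric partial
zero sums of `f ⋆ f̃`, and limits along `atTop` on `ℝ` are unique.
[cite: Bombieri2000Weil, Thm. 2 and §3–§4] -/
theorem energyBddBelow_mul_integral_le_re {L : ℝ}
    (hL : ∀ a : ℝ, 0 < a → L ≤ weilGroundEnergy a) {f : ℝ → ℂ} (hf : IsWeilTest f) :
    L * ∫ t, ‖f t‖ ^ 2 ≤ (WeilConverse.zeroForm f).re := by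
  obtain ⟨r, hr, hsupp⟩ := energyBddBelow_exists_tsupport_subset hf
  have h0 : 0 ≤ ∫ t, ‖f t‖ ^ 2 := integral_nonneg fun _ ↦ by positivity
  have hQ : WeilConverse.zeroForm f = weilQuadratic f :=
    tendsto_nhds_unique (WeilConverse.hasWeilZeroSide_zeroForm hf)
      (explicit_formula_holds (hf.weilConv hf.weilReflect))
  rw [hQ]
  calc L * ∫ t, ‖f t‖ ^ 2 ≤ weilGroundEnergy r * ∫ t, ‖f t‖ ^ 2 :=
        mul_le_mul_of_nonneg_right (hL r (by linarith)) h0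
    _ ≤ (weilQuadratic f).re := ConnesVanSuijlekom.weilGroundEnergy_mul_le_re hf hsupp

/-- **`L²`-norm of the mixed translate**: `∫|g + c g_x|² ≤ 4 ∫|g|²` for `|c| ≤ 1` (pointwise
`|p + q|² ≤ 2|p|² + 2|q|²` and translation invariance of Lebesgue measure). [folklore] -/
theorem energyBddBelow_integral_norm_sq_translateMix_le {g : ℝ → ℂ} (hg : IsWeilTest g) {c : ℂ}
    (hc : ‖c‖ ≤ 1) (x : ℝ) :
    ∫ t, ‖WeilConverse.translateMix g c x t‖ ^ 2 ≤ 4 * ∫ t, ‖g t‖ ^ 2 := by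
  have h2 : Integrable fun t : ℝ ↦ ‖g t‖ ^ 2 := hg.integrable_norm_sq
  have h2' : Integrable fun t : ℝ ↦ ‖g (t - x)‖ ^ 2 := h2.comp_sub_right x
  calc ∫ t, ‖WeilConverse.translateMix g c x t‖ ^ 2
      ≤ ∫ t, (2 * ‖g t‖ ^ 2 + 2 * ‖g (t - x)‖ ^ 2) := by
        refine integral_mono_of_nonneg (Eventually.of_forall fun _ ↦ by positivity)
          ((h2.const_mul 2).add (h2'.const_mul 2)) (Eventually.of_forall fun t ↦ ?_)
        simp only [WeilConverse.translateMix, Pi.add_apply, weilTranslate]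
        have hn : ‖g t + c * g (t - x)‖ ≤ ‖g t‖ + ‖g (t - x)‖ := by
          refine (norm_add_le _ _).trans (add_le_add le_rfl ?_)
          rw [norm_mul]
          exact mul_le_of_le_one_left (norm_nonneg _) hc
        calc ‖g t + c * g (t - x)‖ ^ 2 ≤ (‖g t‖ + ‖g (t - x)‖) ^ 2 :=
              pow_le_pow_left₀ (norm_nonneg _) hn 2
          _ ≤ 2 * ‖g t‖ ^ 2 + 2 * ‖g (t - x)‖ ^ 2 := by
              nlinarith [sq_nonneg (‖g t‖ - ‖g (t - x)‖)]
    _ = 4 * ∫ t, ‖g t‖ ^ 2 := by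
        rw [integral_add (h2.const_mul 2) (h2'.const_mul 2), integral_const_mul,
          integral_const_mul, integral_sub_right_eq_self (fun u : ℝ ↦ ‖g u‖ ^ 2) x]
        ring

/-- **`|B_g(x)| ≤ Re Q(g) - 2 L ∫|g|²` for all real `x`** when `L ≤ 0` bounds `ε` from below on
`a > 0`: expand `Re Q(g + c g_x) ≥ L ∫|g + c g_x|² ≥ 4 L ∫|g|²` (`WeilConverse.zeroForm_translateMix`,
`energyBddBelow_mul_integral_le_re`, `energyBddBelow_integral_norm_sq_translateMix_le`) with
`c = -conj B_g(x)/|B_g(x)|`, for which `c B_g(x) = conj c · A_g(x) = -|B_g(x)|`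
(`WeilConverse.conj_expSum'`); the algebra is that of `WeilConverse.norm_expSum_le`. [folklore] -/
theorem energyBddBelow_norm_expSum_le {L : ℝ} (hL : ∀ a : ℝ, 0 < a → L ≤ weilGroundEnergy a)
    (hL0 : L ≤ 0) {g : ℝ → ℂ} (hg : IsWeilTest g) (x : ℝ) :
    ‖WeilConverse.expSum g x‖ ≤ (WeilConverse.zeroForm g).re - 2 * L * ∫ t, ‖g t‖ ^ 2 := by
  have hQ := energyBddBelow_mul_integral_le_re hL hg
  have hI0 : 0 ≤ ∫ t, ‖g t‖ ^ 2 := integral_nonneg fun _ ↦ by positivity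
  have hLI : 0 ≤ -(L * ∫ t, ‖g t‖ ^ 2) := by nlinarith
  set B := WeilConverse.expSum g x with hBdef
  by_cases hB : B = 0
  · rw [hB, norm_zero]; linarith
  have hA : WeilConverse.expSum' g x = conj B := by
    rw [hBdef, ← WeilConverse.conj_expSum' g x, Complex.conj_conj]
  have hn0 : ‖B‖ ≠ 0 := norm_ne_zero_iff.2 hB
  have hn : (‖B‖ : ℂ) ≠ 0 := by exact_mod_cast hn0
  set c : ℂ := -conj B / (‖B‖ : ℂ) with hc
  have hcB : c * B = -(‖B‖ : ℂ) := by
    rw [hc, div_mul_eq_mul_div, neg_mul, Complex.conj_mul', neg_div]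
    congr 1
    rw [sq, mul_div_assoc, div_self hn, mul_one]
  have hcn : ‖c‖ = 1 := by
    rw [hc, norm_div, norm_neg, Complex.norm_conj, Complex.norm_real, Real.norm_eq_abs, abs_norm,
      div_self hn0]
  have hc1 : Complex.normSq c = 1 := by
    rw [Complex.normSq_eq_norm_sq, hcn, one_pow]
  have h0 := energyBddBelow_mul_integral_le_re hL (WeilConverse.isWeilTest_translateMix hg c x)
  have h4 := energyBddBelow_integral_norm_sq_translateMix_le hg hcn.le x
  have h5 : L * (4 * ∫ t, ‖g t‖ ^ 2) ≤ L * ∫ t, ‖WeilConverse.translateMix g c x t‖ ^ 2 :=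
    mul_le_mul_of_nonpos_left h4 hL0
  rw [WeilConverse.zeroForm_translateMix hg c x, hA, ← map_mul, hcB, hc1] at h0
  simp only [map_neg, Complex.conj_ofReal, Complex.ofReal_one, one_mul, add_re, neg_re,
    Complex.ofReal_re] at h0
  linarith

/-- **No terms off the line**: `m(ρ) P_g(ρ) = 0` for every non-trivial zero `ρ` with
`Re ρ ≠ 1/2`, for every test function `g`, as soon as `ε` is bounded below on `a > 0` by some
`L ≤ 0` — apply `BoundedPowerSum.sum_fiber_eq_zero_of_exp_real` to the bounded series `B_g`
(exponents `ρ - 1/2`, locally finite; the fibre over `ρ₀ - 1/2` is `{ρ₀}`); copy of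
`WeilConverse.order_mul_pairCoeff_eq_zero` with the bound `energyBddBelow_norm_expSum_le`.
[folklore] -/
theorem energyBddBelow_order_mul_pairCoeff_eq_zero {L : ℝ}
    (hL : ∀ a : ℝ, 0 < a → L ≤ weilGroundEnergy a) (hL0 : L ≤ 0)
    {g : ℝ → ℂ} (hg : IsWeilTest g) {ρ₀ : ℂ} (hρ₀ : ρ₀ ∈ ZetaZeros.riemannZetaNontrivialZeros)
    (hre : ρ₀.re ≠ 1 / 2) :
    (riemannZetaZeroOrder ρ₀ : ℂ) * WeilConverse.pairCoeff g ρ₀ = 0 := by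
  have h := Literature.Analysis.Complex.BoundedPowerSum.sum_fiber_eq_zero_of_exp_real
    (ι := ZetaZeros.riemannZetaNontrivialZeros)
    (c := fun ρ ↦ (riemannZetaZeroOrder (ρ : ℂ) : ℂ) * WeilConverse.pairCoeff g ρ)
    (lam := fun ρ ↦ (ρ : ℂ) - 1 / 2) (R := 1 / 2)
    (M := (WeilConverse.zeroForm g).re - 2 * L * ∫ t, ‖g t‖ ^ 2)
    (WeilConverse.summable_norm_pairCoeff hg) (fun ρ ↦ WeilConverse.abs_re_sub_half_le ρ.2)
    (fun z ↦ ?_) (fun x ↦ energyBddBelow_norm_expSum_le hL hL0 hg x) (μ := ρ₀ - 1 / 2)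
    (by simpa [sub_re] using sub_ne_zero.2 hre) {⟨ρ₀, hρ₀⟩} (fun ρ ↦ ?_)
  · simpa using h
  · refine ⟨1, one_pos, ?_⟩
    refine ((riemannZetaNontrivialZeros_finite_inter_ball (z + 1 / 2) 1).preimage
      (Subtype.val_injective.injOn)).subset fun ρ hρ ↦ ?_
    simp only [mem_setOf_eq, Metric.mem_ball, dist_eq_norm] at hρ
    refine ⟨ρ.2, ?_⟩
    rw [Metric.mem_ball, dist_eq_norm]
    rwa [show (ρ : ℂ) - (z + 1 / 2) = (ρ : ℂ) - 1 / 2 - z by ring]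
  · rw [Finset.mem_singleton, sub_left_inj]
    constructor
    · rintro rfl; rfl
    · intro h; exact Subtype.ext h

/-- **Every non-trivial zero lies on the critical line** if `ε` is bounded below on `a > 0` by
some `L ≤ 0`: choose a bump `g` with `Re ĝ > 0` on the horizontal line through `ρ` (which also
passes through `1 - ρ̄`; `exists_isWeilTest_re_weilMellin_pos`), so `P_g(ρ) ≠ 0`, while
`m(ρ) ≥ 1`; copy of `WeilConverse.re_eq_one_half`. [cite: Bombieri2000Weil, Thm. 1] -/
theorem energyBddBelow_re_eq_one_half {L : ℝ}
    (hL : ∀ a : ℝ, 0 < a → L ≤ weilGroundEnergy a) (hL0 : L ≤ 0)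
    {ρ : ℂ} (hρ : ρ ∈ ZetaZeros.riemannZetaNontrivialZeros) : ρ.re = 1 / 2 := by
  by_contra hre
  obtain ⟨g, hg, hpos⟩ := exists_isWeilTest_re_weilMellin_pos ρ.im
  have h := energyBddBelow_order_mul_pairCoeff_eq_zero hL hL0 hg hρ hre
  have hm : (riemannZetaZeroOrder ρ : ℂ) ≠ 0 := by
    have := ZetaZeros.riemannZetaNontrivialZeros.one_le_order hρ
    exact_mod_cast (by omega : riemannZetaZeroOrder ρ ≠ 0)
  have h1 : weilMellin g ρ ≠ 0 := by
    intro h0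
    have := hpos ρ.re
    rw [show (ρ.re : ℂ) + ρ.im * I = ρ from Complex.re_add_im ρ, h0, Complex.zero_re] at this
    exact lt_irrefl _ this
  have h2 : weilMellin g (1 - conj ρ) ≠ 0 := by
    intro h0
    have := hpos (1 - ρ.re)
    rw [show ((1 - ρ.re : ℝ) : ℂ) + ρ.im * I = 1 - conj ρ from ?_, h0, Complex.zero_re] at this
    · exact lt_irrefl _ this
    · apply Complex.ext <;> simp
  exact (mul_ne_zero hm (mul_ne_zero h1 ((map_ne_zero _).2 h2))) h

/-- (E) **`ε` bounded below ⇒ RH.** If the ground energies `ε(a) = weilGroundEnergy a` of Weil's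
truncated form are bounded below uniformly in the window `a > 0`, the Riemann hypothesis holds:
replace the bound `L` by `min L 0 ≤ 0`; every zero of `ζ` in the open critical strip is a
non-trivial zero (`ZetaZeros.riemannZetaNontrivialZeros.mem_iff'`) and lies on the critical line
by `energyBddBelow_re_eq_one_half`; the strip form is Mathlib's `RiemannHypothesis` by
`riemannHypothesis_iff_strip_holds`. [cite: Bombieri2000Weil, Thm. 1 ("if" half)] -/
theorem riemannHypothesis_of_weilGroundEnergy_bddBelow
    (hL : ∃ L : ℝ, ∀ a : ℝ, 0 < a → L ≤ weilGroundEnergy a) : RiemannHypothesis := by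
  obtain ⟨L, hL⟩ := hL
  have hL' : ∀ a : ℝ, 0 < a → min L 0 ≤ weilGroundEnergy a := fun a ha ↦
    (min_le_left _ _).trans (hL a ha)
  exact riemannHypothesis_iff_strip_holds.2 fun _ hs h0 h1 ↦
    energyBddBelow_re_eq_one_half hL' (min_le_right _ _)
      (ZetaZeros.riemannZetaNontrivialZeros.mem_iff'.2 ⟨hs, h0, h1⟩)

end Summit.RiemannHypothesis.RiemannHypothesis.Theorems.GroundStatesConvergeToXi

end
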